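import Mathlib.LinearAlgebra.FiniteDimensional.Lemmas
import Literature.Geometry.DiscreteGeometry.SphericalWedgeVolume
import HarnessLib

/-!
# `dihedralFraction = dih / 2π`: the normalised dihedral angle of `SolidAngleFraction.lean` is
# the dihedral angle — proved

Topic `Literature/Geometry/DiscreteGeometry`; second brick on solid angles after
`SphericalWedgeVolume.lean` (the volume of the intersection of two half-spaces through the
centre with the unit ball is the fraction `(π − ∠(n₁, n₂))/2π`).  `SolidAngleFraction.lean`
defines, for the route `AtomisticToContinuum/…/ReggeStarBounds`, the normalised dihedral angle
`dihedralFraction v w u` along the edge `vw` of the wedge `ℝ(w − v) + cone(u 0, u 1)` as the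
fraction of the unit ball at `v` inside `apexWedge v (w − v) u`, and lists as wanted the theorem
that this is the dihedral angle divided by `2π` (Hales, *Dense Sphere Packings*, Definition 2.66:
`dih(v₀, v₁, v₂, v₃)` is the angle between the components of `v₂ − v₀`, `v₃ − v₀` orthogonal to
`v₁ − v₀`; §3.2: `dih` is `2π` times the volume fraction of the wedge).  This file proves it.

## What is proved

* Part P (any real inner product space): `perpTo a b = b − (⟪a,b⟫/⟪a,a⟫) a`, the component of
  `b` orthogonal to `a`, with its algebra (`inner_left_perpTo`, `perpTo_add_smul`,
  `inner_perpTo_right`, `inner_perpTo_self`, `perpTo_ne_zero`, strict Cauchy–Schwarz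
  `inner_sq_lt_of_linearIndependent`), and **`angle_perpTo_perpTo`**: for independent `a, b` the
  inward normals `n₁ = perpTo a b`, `n₂ = perpTo b a` of the planar wedge `cone(a, b)` make the
  angle `π − ∠(a, b)`; `linearIndependent_perpTo_perpTo`.
* Part F (`ℝ³`): **`apexWedge_eq_inter_halfspaces`** — for `w − v, u 0, u 1` linearly independent,
  `apexWedge v (w − v) u = {x | ⟪n₁, x − v⟫ ≥ 0} ∩ {x | ⟪n₂, x − v⟫ ≥ 0}` with
  `a = perpTo (w − v) (u 0)`, `b = perpTo (w − v) (u 1)`, `n₁ = perpTo a b`, `n₂ = perpTo b a`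
  (the reverse inclusion decomposes `x − v` in the basis `w − v, u 0, u 1`); and the theorem
  **`dihedralFraction_eq_angle_div`**:
  `dihedralFraction v w u = ∠(perpTo (w − v) (u 0), perpTo (w − v) (u 1)) / 2π`,
  with `dihedralFraction_le_half`.

No named facts.  Not here: Girard's formula for `solidAngleFraction` (next brick).

## References

* T. C. Hales, *Dense Sphere Packings: a blueprint for formal proofs*, CUP 2012, Definition 2.66
  and §3.2. [`HalesDSP2012`]
-/

noncomputable section

namespace Literature.Geometry.DiscreteGeometry

open Real RealInnerProductSpace MeasureTheory Metric Set

/-! ### Part P. The component orthogonal to a vector -/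

section Perp

variable {F : Type*} [NormedAddCommGroup F] [InnerProductSpace ℝ F]

/-- The component of `b` orthogonal to `a`: `b − (⟪a, b⟫/⟪a, a⟫) a` (for `a = 0` this is `b`).
[folklore] -/
def perpTo (a b : F) : F := b - (⟪a, b⟫ / ⟪a, a⟫) • a

/-- Unfolding `perpTo`. [folklore] -/
theorem perpTo_def (a b : F) : perpTo a b = b - (⟪a, b⟫ / ⟪a, a⟫) • a := rfl

/-- `perpTo a b ⊥ a`. [folklore] -/
theorem inner_left_perpTo (a b : F) : ⟪a, perpTo a b⟫ = 0 := by
  rcases eq_or_ne a 0 with rfl | ha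
  · simp [perpTo]
  · have haa : ⟪a, a⟫ ≠ 0 := fun h => ha (inner_self_eq_zero.1 h)
    rw [perpTo, inner_sub_right, real_inner_smul_right, div_mul_cancel₀ _ haa, sub_self]

/-- `perpTo a b ⊥ a` (other order). [folklore] -/
theorem inner_perpTo_left (a b : F) : ⟪perpTo a b, a⟫ = 0 := by
  rw [real_inner_comm, inner_left_perpTo]

/-- `b = perpTo a b + (⟪a, b⟫/⟪a, a⟫) a`. [folklore] -/
theorem perpTo_add_smul (a b : F) : perpTo a b + (⟪a, b⟫ / ⟪a, a⟫) • a = b := by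
  rw [perpTo, sub_add_cancel]

/-- `⟪perpTo a b, b⟫ = ‖perpTo a b‖²` (as an inner product). [folklore] -/
theorem inner_perpTo_right (a b : F) : ⟪perpTo a b, b⟫ = ⟪perpTo a b, perpTo a b⟫ := by
  have h : ⟪perpTo a b, perpTo a b + (⟪a, b⟫ / ⟪a, a⟫) • a⟫ = ⟪perpTo a b, perpTo a b⟫ := by
    rw [inner_add_right, real_inner_smul_right, inner_perpTo_left, mul_zero, add_zero]
  rwa [perpTo_add_smul] at h

/-- `‖perpTo a b‖² = ⟪b, b⟫ − ⟪a, b⟫²/⟪a, a⟫` for `a ≠ 0`. [folklore] -/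
theorem inner_perpTo_self {a : F} (ha : a ≠ 0) (b : F) :
    ⟪perpTo a b, perpTo a b⟫ = ⟪b, b⟫ - ⟪a, b⟫ ^ 2 / ⟪a, a⟫ := by
  have haa : ⟪a, a⟫ ≠ 0 := fun h => ha (inner_self_eq_zero.1 h)
  rw [← inner_perpTo_right, perpTo, inner_sub_left, real_inner_smul_left]
  field_simp

/-- For a linearly independent pair, `perpTo a b ≠ 0`. [folklore] -/
theorem perpTo_ne_zero {a b : F} (h : LinearIndependent ℝ ![a, b]) : perpTo a b ≠ 0 := by
  intro h0
  rw [perpTo, sub_eq_zero] at h0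
  exact (LinearIndependent.pair_iff' (h.ne_zero 0)).1 h _ h0.symm

/-- Strict Cauchy–Schwarz for a linearly independent pair: `⟪a, b⟫² < ⟪a, a⟫ ⟪b, b⟫`.
[folklore] -/
theorem inner_sq_lt_of_linearIndependent {a b : F} (h : LinearIndependent ℝ ![a, b]) :
    ⟪a, b⟫ ^ 2 < ⟪a, a⟫ * ⟪b, b⟫ := by
  have ha : a ≠ 0 := h.ne_zero 0
  have haa : 0 < ⟪a, a⟫ := real_inner_self_pos.2 ha
  have hpos : 0 < ⟪perpTo a b, perpTo a b⟫ := real_inner_self_pos.2 (perpTo_ne_zero h)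
  rw [inner_perpTo_self ha] at hpos
  have := (sub_pos.1 hpos)
  rwa [div_lt_iff₀ haa, mul_comm] at this

end Perp

/-! ### Part F. `dihedralFraction = dih / 2π` -/

section DihedralFormula

open InnerProductGeometry Finset

local notation "E3" => EuclideanSpace ℝ (Fin 3)

/-- Unpacking the linear independence of a triple `![d, u₀, u₁]`: a vanishing combination has
vanishing coefficients. [folklore] -/
theorem eq_zero_of_linearIndependent_three {d u₀ u₁ : E3}
    (hli : LinearIndependent ℝ ![d, u₀, u₁]) {s a b : ℝ} (h : s • d + a • u₀ + b • u₁ = 0) :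
    s = 0 ∧ a = 0 ∧ b = 0 := by
  have := Fintype.linearIndependent_iff.1 hli ![s, a, b] (by
    simpa [Fin.sum_univ_three, add_assoc] using h)
  exact ⟨this 0, this 1, this 2⟩

/-- The projections `u₀' = perpTo d u₀`, `u₁' = perpTo d u₁` of two generators independent
from the edge direction `d` are linearly independent. [folklore] -/
theorem linearIndependent_perpTo_pair {d u₀ u₁ : E3} (hli : LinearIndependent ℝ ![d, u₀, u₁]) :
    LinearIndependent ℝ ![perpTo d u₀, perpTo d u₁] := by
  rw [LinearIndependent.pair_iff]
  intro s t hst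
  have h : (-(s * (⟪d, u₀⟫ / ⟪d, d⟫) + t * (⟪d, u₁⟫ / ⟪d, d⟫))) • d + s • u₀ + t • u₁ = 0 := by
    rw [← hst, perpTo, perpTo]
    module
  obtain ⟨-, hs, ht⟩ := eq_zero_of_linearIndependent_three hli h
  exact ⟨hs, ht⟩

/-- Swapping a linearly independent pair. [folklore] -/
theorem linearIndependent_pair_swap {F : Type*} [AddCommGroup F] [Module ℝ F] {a b : F}
    (h : LinearIndependent ℝ ![a, b]) : LinearIndependent ℝ ![b, a] := by
  rw [LinearIndependent.pair_iff] at h ⊢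
  intro s t hst
  obtain ⟨ht, hs⟩ := h t s (by rw [← hst]; abel)
  exact ⟨hs, ht⟩

/-- **The inward normals of a wedge are linearly independent**: with `a, b` independent,
`n₁ = perpTo a b` and `n₂ = perpTo b a` are independent (`αβ = ⟪a,b⟫²/(⟪a,a⟫⟪b,b⟫) < 1`).
[folklore] -/
theorem linearIndependent_perpTo_perpTo {F : Type*} [NormedAddCommGroup F]
    [InnerProductSpace ℝ F] {a b : F} (h : LinearIndependent ℝ ![a, b]) :
    LinearIndependent ℝ ![perpTo a b, perpTo b a] := by
  have ha : a ≠ 0 := h.ne_zero 0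
  have hb : b ≠ 0 := h.ne_zero 1
  have haa : 0 < ⟪a, a⟫ := real_inner_self_pos.2 ha
  have hbb : 0 < ⟪b, b⟫ := real_inner_self_pos.2 hb
  have hcs := inner_sq_lt_of_linearIndependent h
  rw [LinearIndependent.pair_iff]
  intro s t hst
  -- `s n₁ + t n₂ = (t − s α) a + (s − t β) b`
  have hcomb : (t - s * (⟪a, b⟫ / ⟪a, a⟫)) • a + (s - t * (⟪b, a⟫ / ⟪b, b⟫)) • b = 0 := by
    rw [← hst, perpTo, perpTo]
    module
  obtain ⟨h1, h2⟩ := (LinearIndependent.pair_iff.1 h) _ _ hcomb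
  -- so `s (1 − αβ) = 0` with `αβ < 1`
  have hs : s * (⟪a, a⟫ * ⟪b, b⟫ - ⟪a, b⟫ ^ 2) = 0 := by
    rw [real_inner_comm a b] at h2
    have e1 : t = s * (⟪a, b⟫ / ⟪a, a⟫) := by linarith
    rw [e1] at h2
    field_simp at h2
    linear_combination h2
  have hs0 : s = 0 := by
    rcases mul_eq_zero.1 hs with hs0 | hD
    · exact hs0
    · linarith
  refine ⟨hs0, ?_⟩
  rw [hs0, zero_mul, sub_zero] at h1
  exact h1

variable (v w : E3) (u : Fin 2 → E3)

/-- **A nondegenerate wedge is the intersection of two closed half-spaces.**  With edge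
direction `d = w − v`, projected generators `a = perpTo d (u 0)`, `b = perpTo d (u 1)` and inward
normals `n₁ = perpTo a b` (normal to the face through `u 0`, on the side of `u 1`) and
`n₂ = perpTo b a`: `apexWedge v d u = {x | ⟪n₁, x − v⟫ ≥ 0} ∩ {x | ⟪n₂, x − v⟫ ≥ 0}`.
[folklore] -/
theorem apexWedge_eq_inter_halfspaces (hli : LinearIndependent ℝ ![w - v, u 0, u 1]) :
    apexWedge v (w - v) u =
      {x | 0 ≤ ⟪perpTo (perpTo (w - v) (u 0)) (perpTo (w - v) (u 1)), x - v⟫} ∩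
        {x | 0 ≤ ⟪perpTo (perpTo (w - v) (u 1)) (perpTo (w - v) (u 0)), x - v⟫} := by
  -- names
  obtain ⟨d, hd⟩ : ∃ d : E3, d = w - v := ⟨_, rfl⟩
  obtain ⟨a, ha⟩ : ∃ a : E3, a = perpTo d (u 0) := ⟨_, rfl⟩
  obtain ⟨b, hb⟩ : ∃ b : E3, b = perpTo d (u 1) := ⟨_, rfl⟩
  rw [← hd, ← ha, ← hb]
  have hab : LinearIndependent ℝ ![a, b] := by
    rw [ha, hb]; exact linearIndependent_perpTo_pair (hd ▸ hli)
  have hn₁a : ⟪perpTo a b, a⟫ = 0 := inner_perpTo_left a b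
  have hn₂b : ⟪perpTo b a, b⟫ = 0 := inner_perpTo_left b a
  have hda : ⟪d, a⟫ = 0 := by rw [ha]; exact inner_left_perpTo d (u 0)
  have hdb : ⟪d, b⟫ = 0 := by rw [hb]; exact inner_left_perpTo d (u 1)
  have had : ⟪a, d⟫ = 0 := by rw [real_inner_comm]; exact hda
  have hbd : ⟪b, d⟫ = 0 := by rw [real_inner_comm]; exact hdb
  have hn₁d : ⟪perpTo a b, d⟫ = 0 := by
    rw [perpTo, inner_sub_left, real_inner_smul_left, hbd, had]; ring
  have hn₂d : ⟪perpTo b a, d⟫ = 0 := by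
    rw [perpTo, inner_sub_left, real_inner_smul_left, had, hbd]; ring
  have hu0 : u 0 = a + (⟪d, u 0⟫ / ⟪d, d⟫) • d := by rw [ha, perpTo_add_smul]
  have hu1 : u 1 = b + (⟪d, u 1⟫ / ⟪d, d⟫) • d := by rw [hb, perpTo_add_smul]
  have hn₁u0 : ⟪perpTo a b, u 0⟫ = 0 := by
    rw [hu0, inner_add_right, real_inner_smul_right, hn₁a, hn₁d]; ring
  have hn₂u1 : ⟪perpTo b a, u 1⟫ = 0 := by
    rw [hu1, inner_add_right, real_inner_smul_right, hn₂b, hn₂d]; ring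
  have hn₁u1 : ⟪perpTo a b, u 1⟫ = ⟪perpTo a b, perpTo a b⟫ := by
    rw [hu1, inner_add_right, real_inner_smul_right, hn₁d, mul_zero, add_zero, inner_perpTo_right]
  have hn₂u0 : ⟪perpTo b a, u 0⟫ = ⟪perpTo b a, perpTo b a⟫ := by
    rw [hu0, inner_add_right, real_inner_smul_right, hn₂d, mul_zero, add_zero, inner_perpTo_right]
  have hn₁pos : 0 < ⟪perpTo a b, perpTo a b⟫ := real_inner_self_pos.2 (perpTo_ne_zero hab)
  have hn₂pos : 0 < ⟪perpTo b a, perpTo b a⟫ :=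
    real_inner_self_pos.2 (perpTo_ne_zero (linearIndependent_pair_swap hab))
  ext x
  simp only [apexWedge, Set.mem_setOf_eq, Set.mem_inter_iff, Fin.sum_univ_two]
  constructor
  · rintro ⟨s, c, hc, rfl⟩
    have e : v + s • d + (c 0 • u 0 + c 1 • u 1) - v = s • d + c 0 • u 0 + c 1 • u 1 := by abel
    rw [e]
    simp only [inner_add_right, real_inner_smul_right, hn₁d, hn₁u0, hn₁u1, hn₂d, hn₂u1, hn₂u0,
      mul_zero, zero_add, add_zero]
    exact ⟨mul_nonneg (hc 1) hn₁pos.le, mul_nonneg (hc 0) hn₂pos.le⟩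
  · rintro ⟨h1, h2⟩
    -- decompose `x - v` in the basis `d, u 0, u 1`
    have hcard : Fintype.card (Fin 3) = Module.finrank ℝ E3 := by simp
    set B := basisOfLinearIndependentOfCardEqFinrank (hd ▸ hli) hcard with hB
    have hBv : ∀ i, B i = ![d, u 0, u 1] i := fun i => by
      rw [hB, coe_basisOfLinearIndependentOfCardEqFinrank]
    have hx : x - v = B.repr (x - v) 0 • d + B.repr (x - v) 1 • u 0 + B.repr (x - v) 2 • u 1 := by
      conv_lhs => rw [← B.sum_repr (x - v)]
      simp only [Fin.sum_univ_three, hBv]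
      simp
    set s := B.repr (x - v) 0
    set c₀ := B.repr (x - v) 1
    set c₁ := B.repr (x - v) 2
    have h1' : 0 ≤ c₁ := by
      rw [hx] at h1
      simp only [inner_add_right, real_inner_smul_right, hn₁d, hn₁u0, hn₁u1, mul_zero,
        zero_add] at h1
      exact nonneg_of_mul_nonneg_left h1 hn₁pos
    have h2' : 0 ≤ c₀ := by
      rw [hx] at h2
      simp only [inner_add_right, real_inner_smul_right, hn₂d, hn₂u1, hn₂u0, mul_zero,
        zero_add, add_zero] at h2
      exact nonneg_of_mul_nonneg_left h2 hn₂pos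
    refine ⟨s, ![c₀, c₁], fun i => by fin_cases i <;> assumption, ?_⟩
    have : x = v + (x - v) := by abel
    rw [this, hx]
    simp [add_assoc]

/-- **The dihedral angle of the wedge in terms of the inward normals**:
`∠(n₁, n₂) = π − ∠(a, b)`. [folklore] -/
theorem angle_perpTo_perpTo {F : Type*} [NormedAddCommGroup F] [InnerProductSpace ℝ F]
    {a b : F} (h : LinearIndependent ℝ ![a, b]) :
    angle (perpTo a b) (perpTo b a) = π - angle a b := by
  have ha : a ≠ 0 := h.ne_zero 0
  have hb : b ≠ 0 := h.ne_zero 1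
  have haa : 0 < ⟪a, a⟫ := real_inner_self_pos.2 ha
  have hbb : 0 < ⟪b, b⟫ := real_inner_self_pos.2 hb
  have hna : 0 < ‖a‖ := norm_pos_iff.2 ha
  have hnb : 0 < ‖b‖ := norm_pos_iff.2 hb
  have hcs := inner_sq_lt_of_linearIndependent h
  set D := ⟪a, a⟫ * ⟪b, b⟫ - ⟪a, b⟫ ^ 2 with hD
  have hDpos : 0 < D := by rw [hD]; linarith
  have hn₁ : ⟪perpTo a b, perpTo a b⟫ = D / ⟪a, a⟫ := by
    rw [inner_perpTo_self ha, hD]; field_simp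
  have hn₂ : ⟪perpTo b a, perpTo b a⟫ = D / ⟪b, b⟫ := by
    rw [inner_perpTo_self hb, hD, real_inner_comm a b]; field_simp
  have hn₁₂ : ⟪perpTo a b, perpTo b a⟫ = -(⟪a, b⟫ * D / (⟪a, a⟫ * ⟪b, b⟫)) := by
    simp only [perpTo, inner_sub_left, inner_sub_right, real_inner_smul_left,
      real_inner_smul_right, real_inner_comm a b, hD]
    field_simp
    ring
  have hnorm₁ : ‖perpTo a b‖ ^ 2 = D / ⟪a, a⟫ := by rw [← real_inner_self_eq_norm_sq, hn₁]
  have hnorm₂ : ‖perpTo b a‖ ^ 2 = D / ⟪b, b⟫ := by rw [← real_inner_self_eq_norm_sq, hn₂]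
  have haa' : ⟪a, a⟫ = ‖a‖ ^ 2 := real_inner_self_eq_norm_sq a
  have hbb' : ⟪b, b⟫ = ‖b‖ ^ 2 := real_inner_self_eq_norm_sq b
  -- `‖n₁‖ ‖n₂‖ ‖a‖ ‖b‖ = D`
  have hprod : ‖perpTo a b‖ * ‖perpTo b a‖ * (‖a‖ * ‖b‖) = D := by
    have hsq : (‖perpTo a b‖ * ‖perpTo b a‖ * (‖a‖ * ‖b‖)) ^ 2 = D ^ 2 := by
      rw [mul_pow, mul_pow, mul_pow, hnorm₁, hnorm₂, haa', hbb']
      field_simp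
    exact (pow_left_inj₀ (by positivity) hDpos.le two_ne_zero).1 hsq
  have hratio : ⟪perpTo a b, perpTo b a⟫ / (‖perpTo a b‖ * ‖perpTo b a‖) =
      -(⟪a, b⟫ / (‖a‖ * ‖b‖)) := by
    have hne : ‖perpTo a b‖ * ‖perpTo b a‖ ≠ 0 := by
      intro h0; rw [h0, zero_mul] at hprod; exact hDpos.ne' hprod.symm |>.elim
    rw [hn₁₂, haa', hbb', div_eq_iff hne]
    have : ‖perpTo a b‖ * ‖perpTo b a‖ = D / (‖a‖ * ‖b‖) := by
      rw [eq_div_iff (by positivity), hprod]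
    rw [this]
    field_simp
  rw [angle, angle, hratio, Real.arccos_neg]

/-- **`dihedralFraction = dih / 2π`.**  For a nondegenerate wedge (edge direction `w − v` and
generators `u 0`, `u 1` linearly independent), the normalised dihedral angle of
`SolidAngleFraction.lean` — the fraction of the unit ball at `v` inside
`apexWedge v (w − v) u` — equals the dihedral angle along the edge, i.e. the angle between the
components `perpTo (w − v) (u 0)`, `perpTo (w − v) (u 1)` of the generators orthogonal to the
edge (Hales, Definition 2.66: `dih`), divided by `2π`.  Proof: the wedge is the intersection of
the two half-spaces with inward normals `n₁, n₂` (`apexWedge_eq_inter_halfspaces`), whose ball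
fraction is `(π − ∠(n₁, n₂))/2π` (`ballFraction_halfspace_inter_halfspace_apex`), and
`∠(n₁, n₂) = π − dih` (`angle_perpTo_perpTo`).
[cite: HalesDSP2012, Definition 2.66 (dih) and §3.2 (sol, dih as volumes)] -/
theorem dihedralFraction_eq_angle_div (hli : LinearIndependent ℝ ![w - v, u 0, u 1]) :
    dihedralFraction v w u = angle (perpTo (w - v) (u 0)) (perpTo (w - v) (u 1)) / (2 * π) := by
  have hab : LinearIndependent ℝ ![perpTo (w - v) (u 0), perpTo (w - v) (u 1)] :=
    linearIndependent_perpTo_pair hli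
  rw [dihedralFraction, apexWedge_eq_inter_halfspaces v w u hli,
    ballFraction_halfspace_inter_halfspace_apex v (linearIndependent_perpTo_perpTo hab),
    angle_perpTo_perpTo hab, sub_sub_cancel]

/-- In particular `0 < dihedralFraction < 1/2` for a nondegenerate wedge … more precisely
`dihedralFraction ∈ [0, 1/2]` always follows from `0 ≤ dih ≤ π`. [folklore] -/
theorem dihedralFraction_le_half (hli : LinearIndependent ℝ ![w - v, u 0, u 1]) :
    dihedralFraction v w u ≤ 1 / 2 := by
  rw [dihedralFraction_eq_angle_div v w u hli, div_le_iff₀ (by positivity)]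
  have := angle_le_pi (perpTo (w - v) (u 0)) (perpTo (w - v) (u 1))
  linarith

end DihedralFormula

end Literature.Geometry.DiscreteGeometry

end
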